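import Literature.AlgebraicGeometry.Frobenioids.DivSlimRealification
import Literature.AlgebraicGeometry.Frobenioids.ArithmeticDivisorsPerfFactorial
import HarnessLib

/-!
# Frobenioids I, Theorem 6.4 (i): `D = B(Gal(K/F))⁰` is Div-slim with respect to `Φ^rlf` — the arithmetic instance
# of THE realification — PROOF

Mochizuki, *The geometry of Frobenioids I: the general theory*, Kyushu J. Math. **62** (2008) 293–400,
proof of Theorem 6.4 (i), kurims text p. 115 l. 36–37: "and that `D` is Div-slim [relative to `Φ`, hence also relative
to `Φ^pf`, `Φ^rlf`]". [cite: MochizukiFrdI2008, Thm. 6.4 (i) p.115]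

PROOF-ONLY (seat abc-iut-L6-t10 gen 2, S3 sub-DAG holder; row **T64i/L07**, `Φ^rlf` half, THE INSTANCE): abc-iut-L1-d2's
transport `isDivSlim_ofFunctor_rlf` / `isDivSlim_rlfModelOf` (`DivSlimRealification.lean`, over THE realification
`rlfFunctor Φ hΦ` = `(RealificationData.canonical Φ hΦ).rlf`) applied to the constructed arithmetic model `C_{K/F}`:
its divisor monoid `Φ(L) = ⊕ ℤ_{≥0} ⊕ ⊕ ℝ_{≥0}` is perf-factorial (abc-iut-L1-d2's `EffArithDivisor.isPerfFactorial`)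
and `D` is Div-slim w.r.t. `Φ` (abc-iut-L6-t10 gen 0, `arithFrobenioidOps_isDivSlim`). PROVED:
`arithDivisorFunctor_isPerfFactorial`, `arithFrobenioid_rlf_isDivSlim` (for the data of ANY functor into
`F_{Φ^rlf}`), `arithFrobenioid_rlfModel_isDivSlim` (for THE realified model `C_{K/F}^rlf` of any `Ψ ⊆ Φ^gp`).
Together with `arithFrobenioid_perfection_isDivSlim` (`ArithmeticFrobenioidPerfectionDivSlim.lean`) this closes the
bracket "[relative to `Φ`, hence also relative to `Φ^pf`, `Φ^rlf`]" for `C_{K/F}`.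
No definitions; nothing here bears on [IUTchIII] or asserts anything about abc.
-/

noncomputable section

namespace Literature.AlgebraicGeometry.Frobenioids

open CategoryTheory Opposite Function Literature.AnabelianGeometry.EtaleTheta

universe u' v'

variable (F : Type) [Field F] [NumberField F] (K : Type) [Field K] [Algebra F K] [IsGalois F K]

omit [IsGalois F K] in
/-- The arithmetic divisor monoid `Φ : Spec L ↦ Φ(L)` of Ex. 6.3 has perf-factorial values ("`Φ(L) ≠ 0` is
perf-factorial", FrdI p. 113; abc-iut-L1-d2's `EffArithDivisor.isPerfFactorial`). [cite: MochizukiFrdI2008, Ex. 6.3 p.113] -/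
theorem arithDivisorFunctor_isPerfFactorial :
    ∀ X : (FinSubextCat F K)ᵒᵖ, IsPerfFactorial ((arithDivisorFunctor F K).obj X) :=
  fun X => EffArithDivisor.isPerfFactorial X.unop.L

/-- **Theorem 6.4 (i): `D` is Div-slim relative to `Φ^rlf`** (FrdI p. 115 l. 36–37) — for the data of ANY functor
`C' → F_{Φ^rlf}` into the elementary Frobenioid of THE realification of the arithmetic divisor monoid (in particular
for THE realification `C_{K/F}^rlf`). [cite: MochizukiFrdI2008, Thm. 6.4 (i) p.115] -/
theorem arithFrobenioid_rlf_isDivSlim {C' : Type u'} [Category.{v'} C']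
    (F' : C' ⥤ ElemFrobenioid (rlfFunctor (arithDivisorFunctor F K) (arithDivisorFunctor_isPerfFactorial F K))) :
    (PreFrobenioidData.ofFunctor _ F').IsDivSlim :=
  isDivSlim_ofFunctor_rlf (arithDivisorFunctor F K)
    (ModelFrobenioid.toElem (arithDivisorFunctor F K) (unitsFunctor F K) (divNatTrans F K))
    (arithDivisorFunctor_isPerfFactorial F K) F' (by
      have h := arithFrobenioidOps_isDivSlim F K
      rwa [show arithFrobenioidOps F K = ModelFrobenioid.data _ _ _ from ModelFrobenioid.ofModel_eq_data _ _ _] at h)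

/-- **Theorem 6.4 (i), `Φ^rlf` half, at THE realified model**: for every `Ψ ⊆ Φ^gp` (e.g. THE rational function
monoid `Φ^birat`), the data of the realified model Frobenioid `(canonical Φ hΦ).RlfModelOf Ψ` of `C_{K/F}`
(abc-iut-L1-d2, Prop. 5.3) is Div-slim. [cite: MochizukiFrdI2008, Thm. 6.4 (i) p.115] -/
theorem arithFrobenioid_rlfModel_isDivSlim (Ψ : GpSubfunctor (arithDivisorFunctor F K)) :
    (PreFrobenioidData.ofFunctor _
      (ModelFrobenioid.toElem
        (RealificationData.canonical (arithDivisorFunctor F K) (arithDivisorFunctor_isPerfFactorial F K)).rlf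
        ((RealificationData.canonical (arithDivisorFunctor F K) (arithDivisorFunctor_isPerfFactorial F K)).realSpan Ψ).toMonoid
        ((RealificationData.canonical (arithDivisorFunctor F K)
          (arithDivisorFunctor_isPerfFactorial F K)).realSpan Ψ).incl)).IsDivSlim :=
  isDivSlim_rlfModelOf (arithDivisorFunctor F K)
    (ModelFrobenioid.toElem (arithDivisorFunctor F K) (unitsFunctor F K) (divNatTrans F K))
    (arithDivisorFunctor_isPerfFactorial F K) Ψ (by
      have h := arithFrobenioidOps_isDivSlim F K
      rwa [show arithFrobenioidOps F K = ModelFrobenioid.data _ _ _ from ModelFrobenioid.ofModel_eq_data _ _ _] at h)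

end Literature.AlgebraicGeometry.Frobenioids

end
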